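import Mathlib.Order.Filter.AtTopBot.Basic
import Mathlib.SetTheory.Cardinal.Finite
import Mathlib.Data.ENat.Lattice
import Mathlib.Data.Real.Basic
import Mathlib.Algebra.Order.Field.Basic
import Mathlib.Data.Fintype.BigOperators
import Literature.Computability.Complexity.BoolEncodings
import Literature.Computability.Complexity.Circuit
import Literature.Computability.Complexity.Classes
import Literature.Computability.Complexity.CircuitClasses
import Literature.Computability.MetaComplexity.TruthTables
import HarnessLib

-- provenance: harness21/H21/H21/Prelude/CplxMeta/NaturalProofs.lean @ 7c6a0f5 (interim HEAD d8f2665); M5 mechanical rewrite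
/-!
# Complexity meta: Razborov–Rudich natural properties and PRG hardness against circuits

Trunk `CplxMeta` (G14), concept C6 / design decisions D5, D6 of `H21/Outlines/CplxMeta.md`;
realises the notions `natural_property` and `prg_hardness_vs_circuits`.

Sources: A. Razborov, S. Rudich, *Natural proofs*, JCSS 55 (1997), §2 (natural combinatorial
properties: constructivity, largeness, usefulness) and §4 (hardness `H(G)` of a pseudo-random
generator against circuits, Thm. 4.1); S. Arora, B. Barak, *Computational Complexity* (2009),
Def. 23.1 (usefulness against `P/poly` in language form).

## Contents

* `CombinatorialProperty`: a sequence `P = (Pₙ)` of sets of `n`-variable Boolean functions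
  (RR's `Cₙ ⊆ Fₙ`), and its language `CombinatorialProperty.toLanguage` of truth tables.
* `IsConstructive Γ P` (`Γ`-constructivity), `IsLarge P` (largeness `|Pₙ| ≥ 2^{-O(n)} |Fₙ|`),
  `IsUsefulAgainstSize s P`, `IsUsefulAgainstPPoly P`, `IsUsefulAgainst Λ P` (usefulness),
  `IsNatural Γ P` (contains a `Γ`-constructive large sub-property).
* `prgAdvantage C g`, `prgHardness g` (RR's `H(G)`), `PRGFamily`, `PRGFamily.IsInPPoly`.

## Design choices

* **Usefulness is stated per length** (outline review finding 1). Razborov–Rudich word usefulness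
  over *sequences* `f₁, f₂, …` with `fₙ ∈ Cₙ`: "any such sequence has super-polynomial circuit
  size infinitely often". Taken literally that statement is vacuously true as soon as a single
  `Pₙ` is empty (there are then no sequences at all), which would turn the natural-proofs barrier
  (pnp.S18) into an unconditional false claim. We instead require, for every length `n` beyond
  some threshold, that *every* `f ∈ Pₙ` has circuit size `> s n` (`IsUsefulAgainstSize`), for all
  polynomial `s` (`IsUsefulAgainstPPoly`). This a.e./per-length form implies RR's sequence form
  whenever every `Pₙ` is nonempty, and it is the form actually used in the proof of RR Thm. 4.1;
  combined with `IsLarge` (which forces `Pₙ ≠ ∅` for all large `n`, `IsLarge.nonempty_eventually`)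
  it is never vacuous. The language-level, infinitely-often variant of Arora–Barak Def. 23.1 is
  `IsUsefulAgainst`.
* Circuit size is G01's `circuitSizeOver B2` (fan-in-`2` basis with constants; RR are
  basis-robust). By `exists_computes_B2` it is never the `sInf` junk value.
* `prgHardness g : ℕ∞` is an infimum over sizes `S > 0` (D5): allowing `S = 0` would admit the
  empty circuit, whose advantage `≥ 1/0 = 0` holds trivially (Lean's `1/0 = 0`), making every
  hardness `0`. Value `⊤` means no circuit of any size achieves advantage `1/S`; this cannot happen
  for length-increasing generators (`prgHardness_lt_top`).
* Largeness is stated in `ℕ` as `2^(2^n) ≤ 2^(c n) · |Pₙ|` eventually, avoiding real division.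

Mathlib has none of these notions (grep `Razborov`, `natural proof`, `pseudorandom generator`,
`prgAdvantage`: nothing relevant); we reuse `Filter.atTop`, `Filter.Eventually/Frequently`,
`Nat.card`, `Finset.card`/`Finset.filter`, `ℕ∞` and `Polynomial ℕ`. From H21 we use
`truthTableLanguage` (C4 `TruthTables`), `Circuit`, `B2`, `circuitSizeOver` (G01 `Circuit`),
`Language.sliceFn` (G01 `BoolEncodings`), `PPoly`, `SIZE`, `Language.circuitSize`,
`mem_SIZE_iff_circuitSize_le` (G01 `CircuitClasses`). Everything lives in `namespace Literature.CplxMeta`.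
-/

namespace Literature.Computability.MetaComplexity

open _root_.Computability Complexity Filter

/-! ### Combinatorial properties: constructivity, largeness, usefulness, naturalness -/

/-- A *combinatorial property* of Boolean functions: for every `n` a set `Pₙ` of `n`-variable
Boolean functions `f : {0,1}ⁿ → {0,1}` (Razborov–Rudich 1997, §2: "`Cₙ ⊆ Fₙ`"). [cite: RazborovRudich1997, §2: " Cₙ ⊆ Fₙ "] -/
abbrev CombinatorialProperty : Type := ∀ n : ℕ, Set ((Fin n → Bool) → Bool)

variable {k m : ℕ}

/-- The language of a combinatorial property: the set of truth tables `tt(f)`, `f ∈ Pₙ`, `n ∈ ℕ`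
(this is `truthTableLanguage P`; Razborov–Rudich 1997, §2, where the complexity of `P` is by
definition the complexity of this language). [cite: RazborovRudich1997, §2  where the complexity of  P  is by de] -/
def CombinatorialProperty.toLanguage (P : CombinatorialProperty) : Language Bool :=
  truthTableLanguage P

/-- The language of a property is `truthTableLanguage` (by definition). [folklore] -/
@[simp] theorem CombinatorialProperty.toLanguage_eq (P : CombinatorialProperty) :
    P.toLanguage = truthTableLanguage P := rfl

/-- `Γ`-*constructivity* of a combinatorial property `P` for a complexity class
`Γ ⊆ 𝒫({0,1}*)` (typically `Γ = P` or `PPoly`): deciding `f ∈ Pₙ` from the `2ⁿ`-bit truth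
table of `f` is a problem in `Γ`, i.e. the language of truth tables `P.toLanguage` lies in `Γ`
(Razborov–Rudich 1997, §2, "Constructivity"). [cite: RazborovRudich1997, §2  "Constructivity"] -/
def IsConstructive (Γ : Set (Language Bool)) (P : CombinatorialProperty) : Prop :=
  P.toLanguage ∈ Γ

/-- *Largeness* of a combinatorial property: `|Pₙ| ≥ 2^{-O(n)} · |Fₙ|` where `|Fₙ| = 2^(2^n)` is
the number of all `n`-variable Boolean functions; stated in `ℕ` as
`∃ c, ∀ᶠ n, 2^(2^n) ≤ 2^(c·n) · |Pₙ|` (Razborov–Rudich 1997, §2, "Largeness"). Here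
`Nat.card (P n)` is the cardinality of the (finite) set `Pₙ`. [cite: RazborovRudich1997, §2  "Largeness"] -/
def IsLarge (P : CombinatorialProperty) : Prop :=
  ∃ c : ℕ, ∀ᶠ n in atTop, 2 ^ (2 ^ n) ≤ 2 ^ (c * n) * Nat.card (P n)

/-- *Usefulness against size `s`*, per-length almost-everywhere form: for all sufficiently large
`n`, every function `f ∈ Pₙ` has `B₂`-circuit complexity `> s n` (Razborov–Rudich 1997, §2,
"Usefulness", adapted; see the module docstring). RR's literal wording quantifies over sequences
`fₙ ∈ Cₙ` and is vacuously true once some `Pₙ = ∅`; the present form is equivalent to it whenever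
all `Pₙ` are nonempty and is non-vacuous together with `IsLarge`. [cite: RazborovRudich1997, §2  "Usefulness"  adapted] -/
def IsUsefulAgainstSize (s : ℕ → ℕ) (P : CombinatorialProperty) : Prop :=
  ∀ᶠ n in atTop, ∀ f ∈ P n, s n < circuitSizeOver B2 f

/-- *Usefulness against `P/poly`*: `P` is useful against circuits of size `n ^ k` for every `k`,
i.e. for every `k`, for all large `n`, every `f ∈ Pₙ` has circuit size `> n ^ k`
(Razborov–Rudich 1997, §2, "Usefulness" against `P/poly`; per-length form, see
`IsUsefulAgainstSize`). [cite: RazborovRudich1997, §2  "Usefulness" against  P/poly] -/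
def IsUsefulAgainstPPoly (P : CombinatorialProperty) : Prop :=
  ∀ k : ℕ, IsUsefulAgainstSize (fun n => n ^ k) P

/-- *Usefulness against a class of languages `Λ`*, infinitely-often language form: every language
`L` whose slices `L ∩ {0,1}ⁿ` (as Boolean functions, `Language.sliceFn`) have property `Pₙ` for
infinitely many `n` lies outside `Λ` (Arora–Barak 2009, Def. 23.1, with `Λ = P/poly`;
Razborov–Rudich 1997, §2). [cite: AroraBarak2009, Def. 23.1  with  Λ = P/poly] -/
def IsUsefulAgainst (Λ : Set (Language Bool)) (P : CombinatorialProperty) : Prop :=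
  ∀ L : Language Bool, (∃ᶠ n in atTop, L.sliceFn n ∈ P n) → L ∉ Λ

/-- A combinatorial property `P` is `Γ`-*natural* if it contains a sub-property `P' ⊆ P`
(`P'ₙ ⊆ Pₙ` for all `n`) which is `Γ`-constructive and large
(Razborov–Rudich 1997, §2, Definition of a natural property / natural proof). [cite: RazborovRudich1997, §2  Definition of a natural property / n] -/
def IsNatural (Γ : Set (Language Bool)) (P : CombinatorialProperty) : Prop :=
  ∃ P' : CombinatorialProperty, (∀ n, P' n ⊆ P n) ∧ IsConstructive Γ P' ∧ IsLarge P'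

/-! ### Pseudo-random generators and their hardness against circuits -/

/-- The *distinguishing advantage* of a circuit `C` on `m` input bits against a generator
`g : {0,1}ᵏ → {0,1}ᵐ`:
`|Pr_{s ∈ {0,1}ᵏ}[C(g(s)) = 1] - Pr_{y ∈ {0,1}ᵐ}[C(y) = 1]|`, written with exact counts
`#{s | C(g s) = 1} / 2ᵏ` and `#{y | C y = 1} / 2ᵐ` (Razborov–Rudich 1997, §4, definition of
`H(Gₖ)`). [cite: RazborovRudich1997, §4  definition of  H(Gₖ] -/
noncomputable def prgAdvantage (C : Circuit (Fin m)) (g : (Fin k → Bool) → (Fin m → Bool)) : ℝ :=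
  |((Finset.univ.filter fun s : Fin k → Bool => C.eval (g s) = true).card : ℝ) / 2 ^ k -
    ((Finset.univ.filter fun y : Fin m → Bool => C.eval y = true).card : ℝ) / 2 ^ m|

/-- The *hardness* `H(g) ∈ ℕ ∪ {∞}` of a generator `g : {0,1}ᵏ → {0,1}ᵐ` against circuits: the
least `S ≥ 1` such that some `B₂`-circuit of size `≤ S` distinguishes `g` from uniform with
advantage `≥ 1/S` (Razborov–Rudich 1997, §4: "the hardness `H(Gₖ)` of `Gₖ` is the minimal `S` for
which there exists a circuit `C` of size `≤ S` with `|P[C(G(x))=1] - P[C(y)=1]| ≥ 1/S`").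
The side condition `0 < S` excludes the degenerate `S = 0` (in Lean `1/0 = 0`, so the empty
circuit would satisfy the advantage bound and every hardness would be `0`; OUTLINE D5). The value
is `⊤` iff no circuit achieves any inverse-polynomial-in-its-size advantage; see
`prgHardness_lt_top`. [cite: RazborovRudich1997, §4: "the hardness  H(Gₖ] -/
noncomputable def prgHardness (g : (Fin k → Bool) → (Fin m → Bool)) : ℕ∞ :=
  ⨅ (S : ℕ) (_ : 0 < S)
    (_ : ∃ C : Circuit (Fin m), C.IsOver B2 ∧ C.size ≤ S ∧ (1 : ℝ) / S ≤ prgAdvantage C g),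
    (S : ℕ∞)

/-- A *pseudo-random generator family* stretching `k` bits to `2k` bits:
`G = (Gₖ : {0,1}ᵏ → {0,1}²ᵏ)ₖ` (Razborov–Rudich 1997, §4). No pseudo-randomness is built in;
hardness is measured by `prgHardness (G k)`. [cite: RazborovRudich1997, §4] -/
abbrev PRGFamily : Type := ∀ k : ℕ, (Fin k → Bool) → (Fin (2 * k) → Bool)

/-- A generator family `G` is *computable in `P/poly`*: there is a polynomial `p` such that every
output bit `s ↦ (Gₖ s)ᵢ` is computed by a `B₂`-circuit of size `≤ p(k)`
(Razborov–Rudich 1997, §4, hypothesis "`Gₖ` in `P/poly`" of Thm. 4.1). [cite: RazborovRudich1997, §4  hypothesis " Gₖ  in  P/poly " of Thm] -/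
def PRGFamily.IsInPPoly (G : PRGFamily) : Prop :=
  ∃ p : Polynomial ℕ, ∀ (k : ℕ) (i : Fin (2 * k)), circuitSizeOver B2 (fun s => G k s i) ≤ p.eval k

/-! ### API -/

/-- The distinguishing advantage is nonnegative (it is an absolute value)
(Razborov–Rudich 1997, §4). [cite: RazborovRudich1997, §4] -/
theorem prgAdvantage_nonneg (C : Circuit (Fin m)) (g : (Fin k → Bool) → (Fin m → Bool)) :
    0 ≤ prgAdvantage C g :=
  abs_nonneg _

/-- The distinguishing advantage is at most `1` (it is a difference of two probabilities)
(Razborov–Rudich 1997, §4). [cite: RazborovRudich1997, §4] -/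
theorem prgAdvantage_le_one (C : Circuit (Fin m)) (g : (Fin k → Bool) → (Fin m → Bool)) :
    prgAdvantage C g ≤ 1 := by
  unfold prgAdvantage
  have h1 : ∀ (j : ℕ) (p : (Fin j → Bool) → Prop) [DecidablePred p],
      ((Finset.univ.filter p).card : ℝ) / 2 ^ j ≤ 1 := by
    intro j p _
    rw [div_le_one (by positivity)]
    have := Finset.card_filter_le (Finset.univ : Finset (Fin j → Bool)) p
    rw [Finset.card_univ, Fintype.card_pi_const, Fintype.card_bool] at this
    exact_mod_cast this
  have h0 : ∀ (j : ℕ) (p : (Fin j → Bool) → Prop) [DecidablePred p],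
      (0 : ℝ) ≤ ((Finset.univ.filter p).card : ℝ) / 2 ^ j := fun j p _ => by positivity
  rw [abs_sub_le_iff]
  constructor <;> linarith [h1 k (fun s => C.eval (g s) = true), h0 k (fun s => C.eval (g s) = true),
    h1 m (fun y => C.eval y = true), h0 m (fun y => C.eval y = true)]

/-- A length-increasing generator `g : {0,1}ᵏ → {0,1}ᵐ`, `k < m`, has finite hardness: some
`y ∉ range g` exists (counting), and the `B₂`-circuit testing equality with `y` (size `O(m)`)
accepts a uniform string with probability `2⁻ᵐ` and a pseudo-random one with probability `0`, so
it has advantage `2⁻ᵐ ≥ 1/S` for `S = max(size, 2ᵐ)` (Razborov–Rudich 1997, §4, remark after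
the definition of `H(G)`). [cite: RazborovRudich1997, §4  remark after the definition of  H(G] -/
def prgHardness_lt_top : Prop :=
  ∀ (hkm : k < m) (g : (Fin k → Bool) → (Fin m → Bool)),
    prgHardness g < ⊤

/-- A size `S > 0` witnessed by a distinguisher bounds the hardness from above (definition of
`prgHardness` as an infimum; Razborov–Rudich 1997, §4). [cite: RazborovRudich1997, §4] -/
theorem prgHardness_le {g : (Fin k → Bool) → (Fin m → Bool)} {S : ℕ} (hS : 0 < S)
    (C : Circuit (Fin m)) (hC : C.IsOver B2) (hsize : C.size ≤ S)
    (hadv : (1 : ℝ) / S ≤ prgAdvantage C g) : prgHardness g ≤ S :=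
  iInf₂_le_of_le S hS (iInf_le_of_le ⟨C, hC, hsize, hadv⟩ le_rfl)

/-- Largeness is monotone: a property containing a large property is large
(Razborov–Rudich 1997, §2). [cite: RazborovRudich1997, §2] -/
theorem IsLarge.mono {P P' : CombinatorialProperty} (h : IsLarge P) (hP : ∀ n, P n ⊆ P' n) :
    IsLarge P' := by
  obtain ⟨c, hc⟩ := h
  refine ⟨c, ?_⟩
  filter_upwards [hc] with n hn
  exact hn.trans (Nat.mul_le_mul_left _ (Nat.card_mono (Set.toFinite _) (hP n)))

/-- A large property is nonempty at all sufficiently large lengths (since `2^(2^n) > 0`); this is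
what makes per-length usefulness non-vacuous for natural properties
(Razborov–Rudich 1997, §2; OUTLINE review finding 1). [cite: RazborovRudich1997, §2] -/
theorem IsLarge.nonempty_eventually {P : CombinatorialProperty} (h : IsLarge P) :
    ∀ᶠ n in atTop, (P n).Nonempty := by
  obtain ⟨c, hc⟩ := h
  filter_upwards [hc] with n hn
  by_contra hne
  rw [Set.not_nonempty_iff_eq_empty] at hne
  rw [hne] at hn
  simp at hn

/-- Usefulness is antitone in the size bound: useful against size `s` implies useful against any
eventually smaller `s'` (Razborov–Rudich 1997, §2). [cite: RazborovRudich1997, §2] -/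
theorem IsUsefulAgainstSize.anti {s s' : ℕ → ℕ} {P : CombinatorialProperty}
    (h : IsUsefulAgainstSize s P) (hs : ∀ᶠ n in atTop, s' n ≤ s n) :
    IsUsefulAgainstSize s' P := by
  filter_upwards [h, hs] with n hn hs' f hf using lt_of_le_of_lt hs' (hn f hf)

/-- Usefulness passes to sub-properties (Razborov–Rudich 1997, §2). [cite: RazborovRudich1997, §2] -/
theorem IsUsefulAgainstSize.mono {s : ℕ → ℕ} {P P' : CombinatorialProperty}
    (h : IsUsefulAgainstSize s P) (hP : ∀ n, P' n ⊆ P n) : IsUsefulAgainstSize s P' := by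
  filter_upwards [h] with n hn f hf using hn f (hP n hf)

/-- Usefulness against `P/poly` passes to sub-properties (Razborov–Rudich 1997, §2). [cite: RazborovRudich1997, §2] -/
theorem IsUsefulAgainstPPoly.mono {P P' : CombinatorialProperty} (h : IsUsefulAgainstPPoly P)
    (hP : ∀ n, P' n ⊆ P n) : IsUsefulAgainstPPoly P' :=
  fun k => (h k).mono hP

/-- Per-length usefulness against all polynomial sizes implies usefulness against the class
`P/poly` in the language form: if `L ∈ P/poly` then `L.circuitSize n ≤ p(n) ≤ n ^ k` for all
large `n` (G01 `mem_SIZE_iff_circuitSize_le`), so the slices of `L` are eventually outside `Pₙ`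
(Razborov–Rudich 1997, §2; Arora–Barak 2009, Def. 23.1). [cite: RazborovRudich1997, §2] -/
def isUsefulAgainst_PPoly_of_isUsefulAgainstPPoly : Prop :=
  ∀ {P : CombinatorialProperty} (h : IsUsefulAgainstPPoly P),
    IsUsefulAgainst PPoly P

/-- Constructivity is monotone in the class: `Γ ⊆ Γ'` and `Γ`-constructive imply
`Γ'`-constructive (Razborov–Rudich 1997, §2). [cite: RazborovRudich1997, §2] -/
theorem isConstructive_mono {Γ Γ' : Set (Language Bool)} (h : Γ ⊆ Γ') {P : CombinatorialProperty}
    (hP : IsConstructive Γ P) : IsConstructive Γ' P :=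
  h hP

/-- Naturalness is monotone in the property: a property containing a `Γ`-natural property is
`Γ`-natural (Razborov–Rudich 1997, §2: "a property is natural if it *contains* a constructive
large property"). [cite: RazborovRudich1997, §2: "a property is natural if it  contai] -/
theorem IsNatural.mono {Γ : Set (Language Bool)} {P P' : CombinatorialProperty}
    (h : IsNatural Γ P) (hP : ∀ n, P n ⊆ P' n) : IsNatural Γ P' := by
  obtain ⟨P₀, hP₀, hc, hl⟩ := h
  exact ⟨P₀, fun n => (hP₀ n).trans (hP n), hc, hl⟩

/-- Naturalness is monotone in the class `Γ` (Razborov–Rudich 1997, §2). [cite: RazborovRudich1997, §2] -/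
theorem IsNatural.mono_class {Γ Γ' : Set (Language Bool)} (hΓ : Γ ⊆ Γ') {P : CombinatorialProperty}
    (h : IsNatural Γ P) : IsNatural Γ' P := by
  obtain ⟨P₀, hP₀, hc, hl⟩ := h
  exact ⟨P₀, hP₀, isConstructive_mono hΓ hc, hl⟩

end Literature.Computability.MetaComplexity
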